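import Summits.ResolutionOfSingularities.ResolutionOfSingularities.Theorems.WeightedInvariantJOpenPresentationLE3Defs
import Summits.ResolutionOfSingularities.ResolutionOfSingularities.Theorems.WeightedInvariantIota3FlagBridge
import HarnessLib

/-!
# W4.3 door 19897 — THE σ-CANONICITY / DOMINANCE WORDS OF SPEC (Δ12) rev 4 AS TREE DEFINITIONS (PART 1 of 2, definitions only):
# `Iota3.JSigmaCanonicalAt` · `SigmaMaximiserExistsAt` · `SigmaWeightsUniqueAt` · `SigmaFlagDominantAt` · `SigmaOneSidedDominanceAt` ·
# `TwoFlagDominanceAtLevelAt` (with `0 < b`) and the LE3 bodies `JSigmaCanonicalLE3Body` · `SigmaMaximiserExistsLE3Body` · `SigmaPresentationLE3Body` ·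
# `SigmaOneSidedDominanceLE3Body` · `TwoFlagDominanceAtLevelLE3Body`

**Provenance / honest framing.** VERBATIM PORT of the registrar's SPEC (Δ12) rev 4 `L/res-L1-w43-plan-1/JSigmaCanon_sketch.lean` d065476ee61016ce
(299 l., farm rc 0 · 0 sorries; res-L1-w43-plan-1, W4.3 door `stmt-ResolutionOfSingularities-19897`, (o70-a)/(o70-b)/(σ-pres)₃ bookkeeping), dealt as
(F-4) (STATUS 2026-08-27T22:25:19Z), ported by res-L1-type-o4, `--supports stmt-ResolutionOfSingularities-19897 --as helper`.  [OURS · L1 W4.3 · SPEC (Δ12)]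
Every `def … : Prop` here is an OURS CANDIDATE WORD of the door's bookkeeping (a hypothesis shape consumed by landed theorems — (J-can)≤3 and the
dominance words are OPEN), NOT a statement of H. Hironaka's 2017 manuscript (under adjudication; nothing of it asserted or used), not a Literature
fact, not a claim; every theorem is a PROVED reshuffle over the tree's `flagContactFiltration` / `IsSigmaMaximiser` / `jSigmaPtLocal` / `jFlatT`
calculus.  AI-written and AI-ported, weaker than expert review; candidates stay candidates; no progress claim.

The bodies of `SigmaOneSidedDominanceAt` / `SigmaOneSidedDominanceLE3Body` are the binder `hdom` of res-D-brk-1's LANDED `Iota3.jSigmaCanonicalAt_of_oneSided` /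
`LocalEngine.jSigmaCanonicalLE3_of` (…Iota3JSigmaCanonicalOf, p567051) and those of `TwoFlagDominanceAtLevelAt` / `TwoFlagDominanceAtLevelLE3Body` the binder
`hDom` of res-D-pv-036's LANDED `levelBoundLE3_of_dominance` / `sigmaMaximiserExistsLE3_of_dominance` (…Iota3SigmaLevelBoundOfDominance, p575371),
token for token (the landed files spell `topStratumPrime` with `ContactCylinder` opened; same constant) — PART 2 (`…Iota3SigmaPresentationOfDominance`)
re-states those landed theorems through these names by definitional unfolding.  No theorem in this file.
-/

noncomputable section

open IsLocalRing Literature.AlgebraicGeometry.Resolution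
open Summit.ResolutionOfSingularities.ResolutionOfSingularities.Theorems

set_option linter.dupNamespace false

namespace Summit.ResolutionOfSingularities.ResolutionOfSingularities.Cruxes.HypersurfaceCentreConstruction.LocalEngine

namespace Iota3

variable {S : Type} [CommRing S] [IsLocalRing S]

/-- **(J-can) at one `(S, f)`** [OURS · candidate · SPEC (Δ12)]: any two σ-attaining primitive two-flags of `f` (at order `ord f`) have the
same filtration at every level. -/
def JSigmaCanonicalAt (f : S) : Prop :=
  ∀ (g₁ g₂ : S) (q r₁ r₂ : ℕ) (g₁' g₂' : S) (q' r₁' r₂' : ℕ),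
    IsSigmaMaximiser f (adicOrder f).toNat g₁ g₂ q r₁ r₂ → IsPrimitiveTriple q r₁ r₂ →
    IsSigmaMaximiser f (adicOrder f).toNat g₁' g₂' q' r₁' r₂' → IsPrimitiveTriple q' r₁' r₂' →
    ∀ m : ℕ, flagContactFiltration g₁' g₂' q' r₁' r₂' m = flagContactFiltration g₁ g₂ q r₁ r₂ m

/-- **(EX) at one `(S, f)`** [OURS · candidate · SPEC (Δ12)]: some σ-attaining primitive two-flag of `f` exists. -/
def SigmaMaximiserExistsAt (f : S) : Prop :=
  ∃ (g₁ g₂ : S) (q r₁ r₂ : ℕ), IsSigmaMaximiser f (adicOrder f).toNat g₁ g₂ q r₁ r₂ ∧ IsPrimitiveTriple q r₁ r₂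

/-- **The weights of two σ-maximisers are proportional** (both lex conditions); with primitivity they are EQUAL — the S-sized first
step of (J-can), stated as a target. [OURS · candidate · SPEC (Δ12)] -/
def SigmaWeightsUniqueAt (f : S) : Prop :=
  ∀ (g₁ g₂ : S) (q r₁ r₂ : ℕ) (g₁' g₂' : S) (q' r₁' r₂' : ℕ),
    IsSigmaMaximiser f (adicOrder f).toNat g₁ g₂ q r₁ r₂ → IsPrimitiveTriple q r₁ r₂ →
    IsSigmaMaximiser f (adicOrder f).toNat g₁' g₂' q' r₁' r₂' → IsPrimitiveTriple q' r₁' r₂' →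
    q' = q ∧ r₁' = r₁ ∧ r₂' = r₂

/-- **MUTUAL DOMINANCE form of (J-can)** (the content, once the weights agree): the members of the second flag lie in the right levels
of the first.  By symmetry and res-type-070's `flagContactFiltration_eq_of_mem_of_mem` this gives (J-can) (`jSigmaCanonicalAt_of_dominant`).
[OURS · candidate · SPEC (Δ12)] -/
def SigmaFlagDominantAt (f : S) : Prop :=
  ∀ (g₁ g₂ : S) (q r₁ r₂ : ℕ) (g₁' g₂' : S),
    IsSigmaMaximiser f (adicOrder f).toNat g₁ g₂ q r₁ r₂ → IsPrimitiveTriple q r₁ r₂ →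
    IsSigmaMaximiser f (adicOrder f).toNat g₁' g₂' q r₁ r₂ →
    g₁' ∈ flagContactFiltration g₁ g₂ q r₁ r₂ r₁ ∧ g₂' ∈ flagContactFiltration g₁ g₂ q r₁ r₂ r₂

end Iota3

/-! ## The LE3 bodies (positions = binders of res-D-pv-038's landed `hσ` of `JOpenLE3.pointBodyLE3_zero_zero_of`, p560019) -/

open Iota3 in
/-- **(J-can)≤3 = board item (o70-b)** [OURS · candidate · SPEC (Δ12) rev 2; size L]: for every regular local `S` essentially of finite type
over a perfect field of characteristic `p`, `dim S = 3`, `0 ≠ f ∈ 𝔪²`, top `(ν ; ε ; τ)`-stratum the closed point and `ε ≠ 1`: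
`JSigmaCanonicalAt f`. -/
def JSigmaCanonicalLE3Body (p : ℕ) : Prop :=
  ∀ (k₀ : Type) [Field k₀] [CharP k₀ p] [PerfectField k₀]
    (S : Type) [CommRing S] [Algebra k₀ S] [Algebra.EssFiniteType k₀ S] [IsRegularLocalRing S] (f : S),
    ringKrullDim S = (3 : ℕ) → f ≠ 0 → f ∈ (maximalIdeal S) ^ 2 →
    ContactCylinder.topStratumPrime iotaOrdEpsTau S f = maximalIdeal S →
    iotaEps S f ≠ 1 → JSigmaCanonicalAt f

open Iota3 in
/-- **(EX)≤3 = board item (o70-a)** [OURS · candidate · SPEC (Δ12) rev 2; size M]: at the same positions SOME σ-attaining primitive two-flag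
exists. -/
def SigmaMaximiserExistsLE3Body (p : ℕ) : Prop :=
  ∀ (k₀ : Type) [Field k₀] [CharP k₀ p] [PerfectField k₀]
    (S : Type) [CommRing S] [Algebra k₀ S] [Algebra.EssFiniteType k₀ S] [IsRegularLocalRing S] (f : S),
    ringKrullDim S = (3 : ℕ) → f ≠ 0 → f ∈ (maximalIdeal S) ^ 2 →
    ContactCylinder.topStratumPrime iotaOrdEpsTau S f = maximalIdeal S →
    iotaEps S f ≠ 1 → SigmaMaximiserExistsAt f

open Iota3 in
/-- **(σ-pres)₃ = `SigmaPresentationLE3Body p` — THE TEXT OF RECORD = the hypothesis `hσ` of res-D-pv-038's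
`JOpenLE3.pointBodyLE3_zero_zero_of` (p560019) VERBATIM** [OURS · candidate · SPEC (Δ12) rev 2]: at every such position with `ε = 0` the
rule of record `jFlatT` is presented by a minimal generating system with positive weights.  (= the (pres) sub-block of h7
`CanonicalGameClauseHomLE 3 p iotaFlatT jFlatT` at these positions; ⟸ (o70-a) + (o70-b) + the r.s.p. completion, `sigmaPresentationLE3Body_of_bodies`.) -/
def SigmaPresentationLE3Body (p : ℕ) : Prop :=
  ∀ (k₀ : Type) [Field k₀] [CharP k₀ p] [PerfectField k₀]
    (S : Type) [CommRing S] [Algebra k₀ S] [Algebra.EssFiniteType k₀ S] [IsRegularLocalRing S] (f : S),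
    ringKrullDim S = (3 : ℕ) → f ≠ 0 → f ∈ (maximalIdeal S) ^ 2 →
    ContactCylinder.topStratumPrime iotaOrdEpsTau S f = maximalIdeal S → iotaEps S f = 0 →
    ∃ (n : ℕ) (u : Fin n → S) (w : Fin n → ℕ),
      Ideal.span (Set.range u) = maximalIdeal S ∧ (maximalIdeal S).spanFinrank = n ∧ (∀ i, 0 < w i) ∧
      ∀ m : ℕ, weightedMonomialIdeal u w m = jFlatT S f m

/-! ## The dominance words (SPEC (Δ12) rev 3/4 §3) -/

namespace Iota3

variable {S : Type} [CommRing S] [IsLocalRing S]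

/-- **ONE-SIDED DOMINANCE AT `q < r₂`** = the binder `hdom` of res-D-brk-1's `Iota3.jSigmaCanonicalAt_of_oneSided` ((o70-b) PART 2b), VERBATIM:
two σ-maximisers of `f` at `ν = ord f` with the SAME primitive triple `(q; r₁, r₂)`, `q < r₂` ⇒ the first sits in the second's filtration.
(`r₂ = q` needs nothing: PART 1 p564416; mutuality is automatic: PART 2a p565670.) [OURS · candidate · SPEC (Δ12) rev 3; owner res-D-brk-1] -/
def SigmaOneSidedDominanceAt (f : S) : Prop :=
  ∀ (g₁ g₂ g₁' g₂' : S) (q r₁ r₂ : ℕ),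
    IsSigmaMaximiser f (adicOrder f).toNat g₁ g₂ q r₁ r₂ → IsPrimitiveTriple q r₁ r₂ →
    IsSigmaMaximiser f (adicOrder f).toNat g₁' g₂' q r₁ r₂ → q < r₂ →
    g₁ ∈ flagContactFiltration g₁' g₂' q r₁ r₂ r₁ ∧ g₂ ∈ flagContactFiltration g₁' g₂' q r₁ r₂ r₂

/-- **LEVEL-μ DOMINANCE (DOM_μ)** = res-D-pv-038's variant for (L4) of (EX-4) (STATUS 20:20:38Z), no σ-maximality: `0 < b` (rev 4: without it
the instance `a = b = 0` makes both arithmetic clauses trivial and the word asserts dominance at EVERY commonly reached triple — FALSE, witness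
`f = x^ν + y^{3ν} + z^{3ν}`, flags `(x,y)`, `(x,z)`, triple `(1;3,2)`, res-D-pv-038 FINDING 20:30:32Z) and `a/b` bounds the ratio of
every admissible triple reached by `f` (at `ν = ord f`; witnessed by `RatContact.exists_flagReaches_ratio_max`); then for ANY two two-flags
BOTH carrying `f` to level `r₁ν` of a common admissible triple `(q; r₁, r₂)` of ratio `a/b` (hence of maximal ratio), the members of the second
lie in levels `r₁`, `r₂` of the first.  [OURS · candidate · SPEC (Δ12) rev 3; consumer res-D-pv-038 (L4); owner of the proof: res-D-brk-1 if its
argument does not use σ-maximality, else res-D-pv-038] -/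
def TwoFlagDominanceAtLevelAt (f : S) : Prop :=
  ∀ (a b : ℕ), 0 < b → (∀ q' r₁' r₂' : ℕ, AdmissibleTriple q' r₁' r₂' → FlagReaches f (adicOrder f).toNat q' r₁' r₂' → r₁' * b ≤ a * r₂') →
    ∀ (g₁ g₂ g₁' g₂' : S) (q r₁ r₂ : ℕ), AdmissibleTriple q r₁ r₂ → r₁ * b = a * r₂ →
      IsTwoFlag g₁ g₂ → IsTwoFlag g₁' g₂' →
      f ∈ flagContactFiltration g₁ g₂ q r₁ r₂ (r₁ * (adicOrder f).toNat) →
      f ∈ flagContactFiltration g₁' g₂' q r₁ r₂ (r₁ * (adicOrder f).toNat) →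
      g₁' ∈ flagContactFiltration g₁ g₂ q r₁ r₂ r₁ ∧ g₂' ∈ flagContactFiltration g₁ g₂ q r₁ r₂ r₂

end Iota3

open Iota3 in
/-- **ONE-SIDED DOMINANCE ≤3** = the binder `hdom` of res-D-brk-1's `LocalEngine.jSigmaCanonicalLE3_of (p) (hdom)` ((o70-b) PART 2b), VERBATIM:
at the LE3 point-centre positions (`S` regular local, essentially of finite type over a perfect field of characteristic `p`, `dim S = 3`,
`0 ≠ f ∈ 𝔪²`, top `(ν;ε;τ)`-stratum `= {𝔪}`, `ε ≠ 1`), `SigmaOneSidedDominanceAt f` spelled out.  THE HONEST RESIDUE OF (o70-b).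
[OURS · candidate · SPEC (Δ12) rev 3; owner res-D-brk-1 (PART 2c attacks it)] -/
def SigmaOneSidedDominanceLE3Body (p : ℕ) : Prop :=
  ∀ (k₀ : Type) [Field k₀] [CharP k₀ p] [PerfectField k₀]
    (S : Type) [CommRing S] [Algebra k₀ S] [Algebra.EssFiniteType k₀ S] [IsRegularLocalRing S] (f : S),
    ringKrullDim S = (3 : ℕ) → f ≠ 0 → f ∈ (maximalIdeal S) ^ 2 →
    ContactCylinder.topStratumPrime iotaOrdEpsTau S f = maximalIdeal S → iotaEps S f ≠ 1 →
    ∀ (g₁ g₂ g₁' g₂' : S) (q r₁ r₂ : ℕ),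
      IsSigmaMaximiser f (adicOrder f).toNat g₁ g₂ q r₁ r₂ → IsPrimitiveTriple q r₁ r₂ →
      IsSigmaMaximiser f (adicOrder f).toNat g₁' g₂' q r₁ r₂ → q < r₂ →
      g₁ ∈ flagContactFiltration g₁' g₂' q r₁ r₂ r₁ ∧ g₂ ∈ flagContactFiltration g₁' g₂' q r₁ r₂ r₂

open Iota3 in
/-- **LEVEL-μ DOMINANCE ≤3** (same position prefix): `TwoFlagDominanceAtLevelAt f` at the LE3 point-centre positions — the word res-D-pv-038's
(L4) consumes, so that (EX-4) ⟸ this + (L3) + (L5). [OURS · candidate · SPEC (Δ12) rev 3] -/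
def TwoFlagDominanceAtLevelLE3Body (p : ℕ) : Prop :=
  ∀ (k₀ : Type) [Field k₀] [CharP k₀ p] [PerfectField k₀]
    (S : Type) [CommRing S] [Algebra k₀ S] [Algebra.EssFiniteType k₀ S] [IsRegularLocalRing S] (f : S),
    ringKrullDim S = (3 : ℕ) → f ≠ 0 → f ∈ (maximalIdeal S) ^ 2 →
    ContactCylinder.topStratumPrime iotaOrdEpsTau S f = maximalIdeal S → iotaEps S f ≠ 1 →
    TwoFlagDominanceAtLevelAt f

end Summit.ResolutionOfSingularities.ResolutionOfSingularities.Cruxes.HypersurfaceCentreConstruction.LocalEngine
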